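import Summits.ResolutionOfSingularities.ResolutionOfSingularities.Theorems.PAlterationPalterationThesisR1D
import Summits.ResolutionOfSingularities.ResolutionOfSingularities.Theorems.PAlterationPalterationThesisStubPerfectResOfAtoms
import Summits.ResolutionOfSingularities.ResolutionOfSingularities.Theorems.PAlterationPalterationThesisStubAtomsOfPerfectRes
import Summits.ResolutionOfSingularities.ResolutionOfSingularities.Theorems.PAlterationPalterationThesisStubRRLU1OfPicoverOver
import Summits.ResolutionOfSingularities.ResolutionOfSingularities.Theorems.PAlterationPalterationThesisRRLU1OfQuotient
import HarnessLib

/-!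
# `PalterationThesis` (crux stmt-ResolutionOfSingularities-0552), line `Sketch` rev. c3: the
# Picover-side residue in its cover, quotient and `R1D` forms

Helper file of the line lead (c3) for the skeleton `Cruxes/PalterationThesis/Lines/Sketch.lean`
(`--supports stmt-ResolutionOfSingularities-0552`; it does not close the item), companion of
`PAlterationPalterationThesisPerfectAtoms.lean` (notation `Temkin_K`, `RRLU1_K`, `TMP_K`,
`Res_K` as there; everything inlined). It records what the glue stubs
`stub_rrLU1_of_picoverOver` (p138074, perfect fields, COVER form) and `rrLU1_of_quotOver`
(p138517, any field, QUOTIENT form) say about the Picover-side residue of the crux: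

* `quotAtoms_iff_resOver`, `palterationThesis_iff_quotAtoms` — over ANY field `K` of
  characteristic `p`: `Temkin_K ∧ Quot_K ∧ TMP_K ↔ Res_K`, with `Quot_K` = "normal radicial
  QUOTIENTS of regular `K`-varieties are resolvable" (the right-hand side of
  `PerfectQuotient.picoverOver_iff_quotient`); hence the crux ⟺ these three over every field of
  every prime characteristic. Unlike the COVER form PICover, whose passage to the summit needs
  Frobenius domination (F-finiteness, `PicoverToRadicialBottom`) or `DescentPerfectToAll`, the
  quotient form reaches the summit over imperfect fields too, because Temkin's theorem puts the
  regular variety on TOP of the radicial morphism.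
* `perfectRes_iff_picoverOver_and_tmp_of_temkinAt`, `pialtOver_of_temkinAt_picoverOver_tmp` —
  over a PERFECT field the cover form does as well: modulo `Temkin_K`, `Res_K ↔ PICover_K ∧ TMP_K`,
  and the Abramovich–Oort conjecture over `K` follows from `Temkin_K ∧ PICover_K ∧ TMP_K` (item
  0555's squeeze, field by field).
* `rrLU1Perfect_of_r1D`, `atomsPerfect_of_pialtPerfect_r1D` — over a perfect field the rev. c2
  residue `R1D_K` (GLOBAL resolution of the quotients by one `p`-closed vector field) implies the
  rev. c3 residue `RRLU1_K` (their LOCAL uniformization) WITHOUT Temkin or patching, and the old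
  residue pair (PIAlt over `K`, `R1D_K`) implies all three atoms over `K`.

Sources: M. Temkin, J. Algebra 373 (2013), Thm. 1.3.2 and Rem. 1.3.5; J. Kollár, Ann. of Math.
145 (1997), Prop. 6.6; O. Piltant, RACSAM 107 (2013), Prop. 5.1 and Cor. 5.7.
-/

set_option linter.dupNamespace false -- mandated namespace of this single-conjunct summit

noncomputable section

open CategoryTheory AlgebraicGeometry TopologicalSpace IsLocalRing
open Literature.AlgebraicGeometry.Resolution
open Summit.ResolutionOfSingularities.ResolutionOfSingularities.Theses.PAlteration
open Summit.ResolutionOfSingularities.ResolutionOfSingularities.Theorems.PalterationThesis.PerfectTransfer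
open Summit.ResolutionOfSingularities.ResolutionOfSingularities.Theorems.PalterationThesis.PerfectQuotient

namespace Summit.ResolutionOfSingularities.ResolutionOfSingularities.Theorems.PalterationThesis.PerfectAtoms

/-! ## Over ANY field: the quotient form of the Picover-side residue reaches the summit -/

/-- **Over ANY field `K` of characteristic `p`: (Temkin over `K` ∧ `Quot_K` ∧ two-model patching
over `K`) ⟺ resolution over `K`**, where `Quot_K` = "every normal radicial quotient of a regular
`K`-variety is resolvable" (the right-hand side of `PerfectQuotient.picoverOver_iff_quotient`).
Unlike the COVER form PICover, whose passage to the summit needs Frobenius domination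
(F-finiteness, `PicoverToRadicialBottom`) or `DescentPerfectToAll`, the QUOTIENT form works over
imperfect fields as well: Temkin's theorem puts the regular variety on top
(`rrLU1_of_quotOver`, `stub_perfectRes_of_atoms`; converse `quotOver_of_resOver`,
`stub_atoms_of_perfectRes`). [cite: Temkin2013, Thm. 1.3.2 and Rem. 1.3.5 (ii)–(iii)] -/
theorem quotAtoms_iff_resOver (p : ℕ) (hp : p.Prime) (K : Type) [Field K] [CharP K p] :
    ((∀ (F : Type) [Field F] [Algebra K F], (⊤ : IntermediateField K F).FG →
        ∀ O : ValuationSubring F, (∀ c : K, algebraMap K F c ∈ O) →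
          ∃ (L : Type) (_ : Field L) (_ : Algebra F L) (_ : Algebra K L)
            (_ : IsScalarTower K F L),
            FiniteDimensional F L ∧ IsPurelyInseparable F L ∧
            ∃ O' : ValuationSubring L, O'.comap (algebraMap F L) = O ∧
              IsLocallyUniformizable K L O') ∧
      (∀ (X W : Scheme.{0}) [IsIntegral X] [IsIntegral W] (f : X ⟶ Spec (.of K))
        (h : W ⟶ X) [IsDominant h], IsSeparated f → LocallyOfFiniteType f → QuasiCompact f →
        (∀ x : X, IsIntegrallyClosed (X.presheaf.stalk x)) → Scheme.IsRegular W →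
        IsFinite h → UniversallyInjective h → Scheme.HasResolution X) ∧
      (∀ (F : Type) [Field F] [Algebra K F] [Algebra.EssFiniteType K F],
        ∀ M₁ M₂ : ProperModel K F,
          ∃ (N : ProperModel K F) (φ₁ : N.Hom M₁) (φ₂ : N.Hom M₂), φ₁.RegLe ∧ φ₂.RegLe)) ↔
    ∀ (X : Scheme.{0}) (f : X ⟶ Spec (.of K)),
      IsSeparated f → LocallyOfFiniteType f → QuasiCompact f → IsReduced X →
      Scheme.HasResolution X :=
  ⟨fun h => stub_perfectRes_of_atoms p hp K h.1 (rrLU1_of_quotOver p hp K h.2.1) h.2.2,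
    fun h => ⟨(stub_atoms_of_perfectRes p hp K h).1, quotOver_of_resOver K h,
      (stub_atoms_of_perfectRes p hp K h).2.2⟩⟩

/-- **The crux `PalterationThesis` ⟺ over every field of every prime characteristic: Temkin
2013 Thm. 1.3.2, resolution of the normal radicial quotients of regular varieties, and two-model
patching** — the quotient-side, all-fields display of the crux (no descent statement, no
radicial-bottom step). [folklore] -/
theorem palterationThesis_iff_quotAtoms :
    PalterationThesis ↔
      ∀ p : ℕ, p.Prime → ∀ (K : Type) [Field K] [CharP K p],
        (∀ (F : Type) [Field F] [Algebra K F], (⊤ : IntermediateField K F).FG →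
          ∀ O : ValuationSubring F, (∀ c : K, algebraMap K F c ∈ O) →
            ∃ (L : Type) (_ : Field L) (_ : Algebra F L) (_ : Algebra K L)
              (_ : IsScalarTower K F L),
              FiniteDimensional F L ∧ IsPurelyInseparable F L ∧
              ∃ O' : ValuationSubring L, O'.comap (algebraMap F L) = O ∧
                IsLocallyUniformizable K L O') ∧
        (∀ (X W : Scheme.{0}) [IsIntegral X] [IsIntegral W] (f : X ⟶ Spec (.of K))
          (h : W ⟶ X) [IsDominant h], IsSeparated f → LocallyOfFiniteType f → QuasiCompact f →
          (∀ x : X, IsIntegrallyClosed (X.presheaf.stalk x)) → Scheme.IsRegular W →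
          IsFinite h → UniversallyInjective h → Scheme.HasResolution X) ∧
        (∀ (F : Type) [Field F] [Algebra K F] [Algebra.EssFiniteType K F],
          ∀ M₁ M₂ : ProperModel K F,
            ∃ (N : ProperModel K F) (φ₁ : N.Hom M₁) (φ₂ : N.Hom M₂), φ₁.RegLe ∧ φ₂.RegLe) := by
  rw [palterationThesis_iff_resolutionOfSingularities]
  refine forall_congr' fun p => forall_congr' fun hp => ?_
  exact ⟨fun h K _ _ => (quotAtoms_iff_resOver p hp K).mpr fun X f hs hl hq hr =>
      h K X f hs hl hq hr,
    fun h K _ _ X f hs hl hq hr => (quotAtoms_iff_resOver p hp K).mp (h K) X f hs hl hq hr⟩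

/-! ## Over a perfect field: PICover and patching give everything (fieldwise squeeze) -/

/-- **Over a PERFECT field `K` of characteristic `p`, modulo Temkin's theorem over `K`:
resolution over `K` ⟺ PICover over `K` ∧ two-model patching over `K`** — item 0555's
`resolutionOfSingularities_iff_picover_and_twoModelPatching` for ONE perfect ground field
(`⇐`: PICover over `K` gives RRLU1 over `K`, `stub_rrLU1_of_picoverOver`, then
`stub_perfectRes_of_atoms`; `⇒`: `picoverOver_of_forall_hasResolution` and
`stub_atoms_of_perfectRes`). [cite: Temkin2013, Thm. 1.3.2 and Rem. 1.3.5 (i)] -/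
theorem perfectRes_iff_picoverOver_and_tmp_of_temkinAt (p : ℕ) (hp : p.Prime) (K : Type)
    [Field K] [CharP K p] [PerfectField K]
    (hT : ∀ (F : Type) [Field F] [Algebra K F], (⊤ : IntermediateField K F).FG →
      ∀ O : ValuationSubring F, (∀ c : K, algebraMap K F c ∈ O) →
        ∃ (L : Type) (_ : Field L) (_ : Algebra F L) (_ : Algebra K L) (_ : IsScalarTower K F L),
          FiniteDimensional F L ∧ IsPurelyInseparable F L ∧
          ∃ O' : ValuationSubring L, O'.comap (algebraMap F L) = O ∧
            IsLocallyUniformizable K L O') :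
    (∀ (X : Scheme.{0}) (f : X ⟶ Spec (.of K)),
      IsSeparated f → LocallyOfFiniteType f → QuasiCompact f → IsReduced X →
      Scheme.HasResolution X) ↔
    (∀ (Y X : Scheme.{0}) (f : Y ⟶ Spec (.of K)) (g : X ⟶ Y),
        IsSeparated f → LocallyOfFiniteType f → QuasiCompact f → IsIntegral Y →
        Scheme.IsRegular Y → IsIntegral X → IsFinite g → UniversallyInjective g →
        Function.Surjective g.base → Scheme.HasResolution X) ∧
      (∀ (F : Type) [Field F] [Algebra K F] [Algebra.EssFiniteType K F],
        ∀ M₁ M₂ : ProperModel K F,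
          ∃ (N : ProperModel K F) (φ₁ : N.Hom M₁) (φ₂ : N.Hom M₂), φ₁.RegLe ∧ φ₂.RegLe) := by
  constructor
  · intro h
    refine ⟨picoverOver_of_forall_hasResolution K fun X f hs hl hq hi => ?_,
      (stub_atoms_of_perfectRes p hp K h).2.2⟩
    haveI := hi
    exact h X f hs hl hq inferInstance
  · rintro ⟨hPC, hZ⟩
    exact stub_perfectRes_of_atoms p hp K hT (stub_rrLU1_of_picoverOver p hp K hPC) hZ

/-- **Over a perfect field `K` of characteristic `p`, the Abramovich–Oort conjecture over `K`
follows from Temkin's theorem over `K`, PICover over `K` and two-model patching over `K`** —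
item 0555's `pialt_of_temkin2013_picover_twoModelPatching`, field by field (a resolution is a
purely inseparable regular alteration, `pialtOver_of_forall_hasResolution`). [folklore] -/
theorem pialtOver_of_temkinAt_picoverOver_tmp (p : ℕ) (hp : p.Prime) (K : Type) [Field K]
    [CharP K p] [PerfectField K]
    (hT : ∀ (F : Type) [Field F] [Algebra K F], (⊤ : IntermediateField K F).FG →
      ∀ O : ValuationSubring F, (∀ c : K, algebraMap K F c ∈ O) →
        ∃ (L : Type) (_ : Field L) (_ : Algebra F L) (_ : Algebra K L) (_ : IsScalarTower K F L),
          FiniteDimensional F L ∧ IsPurelyInseparable F L ∧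
          ∃ O' : ValuationSubring L, O'.comap (algebraMap F L) = O ∧
            IsLocallyUniformizable K L O')
    (hPC : ∀ (Y X : Scheme.{0}) (f : Y ⟶ Spec (.of K)) (g : X ⟶ Y),
      IsSeparated f → LocallyOfFiniteType f → QuasiCompact f → IsIntegral Y →
      Scheme.IsRegular Y → IsIntegral X → IsFinite g → UniversallyInjective g →
      Function.Surjective g.base → Scheme.HasResolution X)
    (hZ : ∀ (F : Type) [Field F] [Algebra K F] [Algebra.EssFiniteType K F],
      ∀ M₁ M₂ : ProperModel K F,
        ∃ (N : ProperModel K F) (φ₁ : N.Hom M₁) (φ₂ : N.Hom M₂), φ₁.RegLe ∧ φ₂.RegLe) :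
    ∀ (X : Scheme.{0}) (f : X ⟶ Spec (.of K)),
      IsSeparated f → LocallyOfFiniteType f → QuasiCompact f → IsIntegral X →
      ∃ (X' : Scheme.{0}) (g : X' ⟶ X), IsProper g ∧ IsIntegral X' ∧ Scheme.IsRegular X' ∧
        Function.Surjective g.base ∧ ∃ U : X.Opens, Dense (U : Set X) ∧ IsFinite (g ∣_ U) ∧
        UniversallyInjective (g ∣_ U) := by
  refine pialtOver_of_forall_hasResolution K fun X f hs hl hq hi => ?_
  haveI := hi
  exact (perfectRes_iff_picoverOver_and_tmp_of_temkinAt p hp K hT).mpr ⟨hPC, hZ⟩ X f hs hl hq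
    inferInstance

/-! ## The Picover-side residue got weaker: `R1D_K ⟹ RRLU1_K` over a perfect field -/

/-- **The rev. c2 Picover residue implies the rev. c3 one**: over a perfect field `K`, `R1D_K`
(resolution of the normalisations `B^E` of regular `B` in index-`p` subextensions
`E ⊆ K(B)^{1/p}` — quotients of regular varieties by one `p`-closed vector field) implies RRLU1
over `K` (local uniformization below height-one Frobenius sandwiches), through PICover over `K`
(`picoverOver_of_r1D`) and `stub_rrLU1_of_picoverOver` — WITHOUT Temkin or patching.
[cite: Temkin2013, Rem. 1.3.5 (i)] -/
theorem rrLU1Perfect_of_r1D (p : ℕ) (hp : p.Prime) (K : Type) [Field K] [CharP K p]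
    [PerfectField K]
    (hR1D : ∀ (B : Scheme.{0}) [IsIntegral B] (f : B ⟶ Spec (.of K)),
        IsSeparated f → LocallyOfFiniteType f → QuasiCompact f → Scheme.IsRegular B →
        ∀ (E : Type) [Field E] [Algebra B.functionField E] [FiniteDimensional B.functionField E]
          (β : E →+* B.functionField),
          (∀ b : B.functionField, β (algebraMap B.functionField E b) = b ^ p) →
          Module.finrank β.fieldRange B.functionField = p →
          Scheme.HasResolution (normalizationIn B E)) :
    ∀ (F L : Type) [Field F] [Field L] [Algebra K F] [Algebra F L] [Algebra K L]
      [IsScalarTower K F L], (⊤ : IntermediateField K F).FG → IsPurelyInseparable F L →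
      (∃ y : L, y ^ p ∈ (algebraMap F L).range ∧ IntermediateField.adjoin F {y} = ⊤) →
      ∀ B : Subalgebra K L, B.FG → IsFractionRing B L → IsRegularRing B →
      ∀ O : ValuationSubring L, B.toSubring ≤ O.toSubring →
        IsLocallyUniformizable K F (O.comap (algebraMap F L)) :=
  stub_rrLU1_of_picoverOver p hp K (picoverOver_of_r1D p hp K hR1D)

/-- **The rev. c2 residue pair implies all three rev. c3 atoms** over a perfect field `K`: PIAlt
over `K` and `R1D_K` give resolution over `K` (`pialtOver_and_picoverOver_iff_perfectField`,
`picoverOver_of_r1D`), hence the atoms (`stub_atoms_of_perfectRes`). [folklore] -/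
theorem atomsPerfect_of_pialtPerfect_r1D (p : ℕ) (hp : p.Prime) (K : Type) [Field K] [CharP K p]
    [PerfectField K]
    (hPI : ∀ (X : Scheme.{0}) (f : X ⟶ Spec (.of K)),
      IsSeparated f → LocallyOfFiniteType f → QuasiCompact f → IsIntegral X →
      ∃ (X' : Scheme.{0}) (g : X' ⟶ X), IsProper g ∧ IsIntegral X' ∧ Scheme.IsRegular X' ∧
        Function.Surjective g.base ∧ ∃ U : X.Opens, Dense (U : Set X) ∧ IsFinite (g ∣_ U) ∧
        UniversallyInjective (g ∣_ U))
    (hR1D : ∀ (B : Scheme.{0}) [IsIntegral B] (f : B ⟶ Spec (.of K)),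
        IsSeparated f → LocallyOfFiniteType f → QuasiCompact f → Scheme.IsRegular B →
        ∀ (E : Type) [Field E] [Algebra B.functionField E] [FiniteDimensional B.functionField E]
          (β : E →+* B.functionField),
          (∀ b : B.functionField, β (algebraMap B.functionField E b) = b ^ p) →
          Module.finrank β.fieldRange B.functionField = p →
          Scheme.HasResolution (normalizationIn B E)) :
    (∀ (F : Type) [Field F] [Algebra K F], (⊤ : IntermediateField K F).FG →
      ∀ O : ValuationSubring F, (∀ c : K, algebraMap K F c ∈ O) →
        ∃ (L : Type) (_ : Field L) (_ : Algebra F L) (_ : Algebra K L) (_ : IsScalarTower K F L),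
          FiniteDimensional F L ∧ IsPurelyInseparable F L ∧
          ∃ O' : ValuationSubring L, O'.comap (algebraMap F L) = O ∧
            IsLocallyUniformizable K L O') ∧
    (∀ (F L : Type) [Field F] [Field L] [Algebra K F] [Algebra F L] [Algebra K L]
      [IsScalarTower K F L], (⊤ : IntermediateField K F).FG → IsPurelyInseparable F L →
      (∃ y : L, y ^ p ∈ (algebraMap F L).range ∧ IntermediateField.adjoin F {y} = ⊤) →
      ∀ B : Subalgebra K L, B.FG → IsFractionRing B L → IsRegularRing B →
      ∀ O : ValuationSubring L, B.toSubring ≤ O.toSubring →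
        IsLocallyUniformizable K F (O.comap (algebraMap F L))) ∧
    (∀ (F : Type) [Field F] [Algebra K F] [Algebra.EssFiniteType K F],
      ∀ M₁ M₂ : ProperModel K F,
        ∃ (N : ProperModel K F) (φ₁ : N.Hom M₁) (φ₂ : N.Hom M₂), φ₁.RegLe ∧ φ₂.RegLe) :=
  stub_atoms_of_perfectRes p hp K
    ((pialtOver_and_picoverOver_iff_perfectField p hp K).mp ⟨hPI, picoverOver_of_r1D p hp K hR1D⟩)

end Summit.ResolutionOfSingularities.ResolutionOfSingularities.Theorems.PalterationThesis.PerfectAtoms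

end
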